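import Summits.CriticalPhenomena.Ising3D.ExclusionSentences

/-!
# Exclusion sentences — kernel-checked 2D-control instances (cell `pub-ising3x`, seat recog-1)

HONEST FRAMING: lottery ticket; floor = tightest certified 3D Ising CFT bounds; no exact-solution
claim without a proof.

Instances of the checkers of `ExclusionSentences.lean` on the 2D CONTROL values of the cell's blind
protocol (SCOPE.md §4: Onsager/BPZ data `Δ_σ = 1/8 = 2h_{1,2}(M(3,4))`, `Δ_ε = 1 = 2h_{2,1}(M(3,4))`,
recognised blind at 6 resp. 5 certified digits by the frozen recogniser, round R2), each evaluated by ONE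
`decide +kernel`: the RAT sentence at denominator bounds 16 / 100, the KAC sentence against the FULL
frozen table (`p′ ≤ 24`, `n ≤ 8`, 69 545 values; ≈ 9 s of kernel time), its non-vacuity, and the
printed-shape consequence `control_sigma_kac_unique`. No 3D digit is used; certified 2D intervals
(controls Stage RB, phase 1) and certified 3D intervals get their sentences in files of their own.
-/

namespace Summit.CriticalPhenomena.Ising3D

/-! ### Kernel-checked examples (2D control values only) -/

/-- 2D control, `Δ_σ = 1/8` at six certified digits: the only rational of denominator `≤ 16` in
`[1/8 − 10⁻⁶, 1/8 + 10⁻⁶]` is `1/8` (the recogniser's RAT verdict on the blind round R2, rung `k = 6`). -/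
theorem ratExcluded_control_sigma :
    ratExcluded 16 (1 / 8 - 1 / 10 ^ 6) (1 / 8 + 1 / 10 ^ 6) [1 / 8] = true := by
  decide +kernel

/-- 2D control, `Δ_ε = 1` at five certified digits: the only rational of denominator `≤ 100` in
`[1 − 10⁻⁵, 1 + 10⁻⁵]` is `1`. -/
theorem ratExcluded_control_eps :
    ratExcluded 100 (1 - 1 / 10 ^ 5) (1 + 1 / 10 ^ 5) [1] = true := by
  decide +kernel

/-- 2D control, `Δ_σ = 1/8` at six certified digits against the FULL frozen Kac table (`p′ ≤ 24`,
`n ≤ 8`, 69 545 values): the only member in `[1/8 − 10⁻⁶, 1/8 + 10⁻⁶]` is `1/8 = 2h_{1,2}(M(3,4))`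
itself. One `decide +kernel`, ≈ 9 s of kernel time. -/
theorem kacExcluded_control_sigma :
    kacExcluded 24 8 (1 / 8 - 1 / 10 ^ 6) (1 / 8 + 1 / 10 ^ 6) [1 / 8] = true := by
  decide +kernel

/-- … and the sentence is not vacuous: with an empty exception list the checker answers `false`. -/
theorem kacExcluded_control_sigma_nonvacuous :
    kacExcluded 24 8 (1 / 8 - 1 / 10 ^ 6) (1 / 8 + 1 / 10 ^ 6) [] = false := by
  decide +kernel

/-- Consequence of the two control sentences, in the shape the floor paper prints: a real number
within `10⁻⁶` of `1/8` that is a Kac-table value (`p′ ≤ 24`, `n ≤ 8`) IS `1/8`. -/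
theorem control_sigma_kac_unique {x : ℝ}
    (hx : ((1 / 8 - 1 / 10 ^ 6 : ℚ) : ℝ) ≤ x ∧ x ≤ ((1 / 8 + 1 / 10 ^ 6 : ℚ) : ℝ)) (v : ℚ)
    (hv : v ∈ kacFamily 24 8) (hxv : x = (v : ℝ)) : v = 1 / 8 := by
  by_contra hne
  exact ne_kac_of_kacExcluded kacExcluded_control_sigma hx v hv (by simpa using hne) hxv

end Summit.CriticalPhenomena.Ising3D
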